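import Literature.MathematicalPhysics.QuantumFieldTheory.Balaban1983to89.Node00.Sect2FormOfRecord
import Literature.MathematicalPhysics.QuantumFieldTheory.Balaban1983to89.Node00.TkWeightsOfRecordP

/-!
# DAG node N11 — (PC) PREFIX CONGRUENCE OF THE 𝐓-SIDE OBJECTS IN THE WEIGHT DATUM: the branch operator `𝐓_k(s, S)`, the slot family `𝐓_k(s)` and the §2-form
# slot at length `k` read the weight datum `W` ONLY THROUGH ITS GENERATIONS `j < k` — two weight data agreeing there give the SAME objects (generic 11a faces;
# the bridge the history-indexed edition H1ʰ of the residual slot needs between the weights of `init s` and of `s`)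

Cell `pub-ymgap`, YM-PLAN Track A (HUMAN RULING D-0062), seat `pub-ymgap-dag-n11-d` (g7; R134 fan-out seat N11 [B14], strategy s2), route `BalabanUVNodes`
rev 22, item K1⁶ `StabilityBAtRecordR13SepCoPR` = stmt-QuantumFields-20507 (helper, count-neutral).  [III] = [Balaban1988Convergent].  Over 11a's
`Node00/TkOfRecord` (`tkOp`, `genOp`, `genDataOfRecord`, `tkBranchOfRecord`, `TkOfRecord`, `tkOn218`∕`atScale`), 11c∕12's `Node00/Sect2FormOfRecord` (`sect2Slot`)
and 12a″'s `Node00/TkWeightsOfRecordP` (`tkWeightsOfRecordP`) only.  Sibling of this seat's (L)+(SL) faces `…TkBranchLinearLocal` (p527289).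

WHY THIS FILE (node00-def-T LOCATED-9 «history-blind residual 𝐓-weight slot», this seat's Q-HIST ∕ DESIGN-INPUT-H1ʰ «PREFIX LAW»).  The inductive 𝐓-step of (S1ᵀ)
at a new sequence `s` of length `k+1` COMPARES the §2 form of `ρ_k` at `init s` — old branches `𝐓_k(init s, S)` built from the weights' generations `j < k` —
with the 𝐓-image clause at `s`, whose `sect2Slot … W s …` contains the same old branches plus the new generation-`k` factor.  In the history-blind editions
(v1.3–v1.6) both are ONE datum `W`; in a history-indexed edition (def-T's H1ʰ: `W s := tkWeightsOfRecordP … (θ.Zh p n s.Ω s.Λ)`) they are `W (init s)` and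
`W s`, and the step needs them to AGREE ON THE GENERATIONS `j < k`.  This file proves, once and generically, that such prefix agreement is all the 𝐓-side objects
read: (PC) for `tkOp` from its generations below `k`, for one generation's data from `(ζ_j, w_j)`, for the branch operator, for 11a's slot family `TkOfRecord … k s`
and for the §2-form slot `sect2Slot … s` (length `k`), and — for 12a″'s weights over residual data `Z₁, Z₂` — from `Z₁.ζ0 j = Z₂.ζ0 j`, `Z₁.quad j = Z₂.quad j`
(`j < k`; any fluctuation space `V`).  So a v1.7 prefix law `(θ.Zh p (k+1) s).ζ0 j = (θ.Zh p k (init s)).ζ0 j` (and `quad`), `j < k`, transports every `hid`-hypothesis of this seat's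
clause-keyed step (`…NoExpansionDiagonalClauseStep`) from `W (init s)` to `W s` by ONE rewrite.

WHAT THIS FILE PROVES (0 `sorry`, 0 `def`, standard axioms; generic torus, `N`, fluctuation space `V`, numerics, sequences, branches).  `tkOp_congr_of_lt` ·
`genDataOfRecord_congr_of_weights` · ★ `tkBranchOfRecord_congr_of_weights` · ★ `TkOfRecord_congr_of_weights` · ★ `sect2Slot_congr_of_weights` · `TkWeights.w_congr` ·
`tkWeightsOfRecordP_ζ_congr` ∕ `tkWeightsOfRecordP_w_congr` ∕ ★ `sect2Slot_tkWeightsOfRecordP_congr_of_prefix` (two residual data agreeing on `ζ0`, `quad` below `k`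
give the same §2-form slot at length `k`).

HONEST FRAMING.  Definitional bookkeeping on 11a's recursion (count-neutral); nothing of Bałaban's asserted; no v1.7 object is declared or presumed (the file is
stated for arbitrary pairs of weight data).  N11 NOT discharged; counts unmoved (typed 28∕28 · discharged 5∕28).  One finite four-torus programme at fixed
`ε = L^{−K}`; NOT ℝ⁴, NOT OS, NOT a mass gap, NOT Clay.  Sources: [III] (2.20)–(2.21) p.258, (3.24) p.270, p.257 L31–34 («A_k depends on the sequences
{Ω_j},{Λ_j},{S_j}; we suppress this dependence»), p.267 L15–20.
-/

noncomputable section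

open MeasureTheory
open scoped BigOperators Matrix.Norms.L2Operator

namespace Summit.QuantumFields.YangMills.Theorems.BalabanUVNodesN11TkBranchWeightCongr

open Literature.MathematicalPhysics.QuantumFieldTheory.Balaban1983to89 T4Continuum Node00 Node00.Tk DagBinding
open B15DeterminingSets

/-! ## §1. (PC) for the ordered product, one generation's data, the branch operator, the slot family -/

section Generic

variable {P : Params} {G : Type} {V : Type}

/-- **(PC) FOR THE ORDERED PRODUCT**: `𝐓_k` reads the generations `j < k` only. [cite: Balaban1988Convergent, (2.20) p.258, (3.24) p.270] -/
theorem tkOp_congr_of_lt (gen₁ gen₂ : ℕ → (MultiCfg P G V → ℝ) → (MultiCfg P G V → ℝ)) :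
    ∀ k : ℕ, (∀ j, j < k → gen₁ j = gen₂ j) → tkOp gen₁ k = tkOp gen₂ k
  | 0, _ => rfl
  | k + 1, h => by
      funext Φ
      rw [tkOp_succ, tkOp_succ, tkOp_congr_of_lt gen₁ gen₂ k (fun j hj => h j (Nat.lt_succ_of_lt hj)), h k (Nat.lt_succ_self k)]

end Generic

section Record

variable {F : T4Family} {N : ℕ} [NeZero N] {V : Type} [NormedAddCommGroup V] [InnerProductSpace ℝ V] [FiniteDimensional ℝ V]
  [MeasurableSpace V] [BorelSpace V]
variable (ν : Stage7Numerics) (M : ℕ) (g : ℕ → ℝ) (K : ℕ)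

omit [NormedAddCommGroup V] [InnerProductSpace ℝ V] [FiniteDimensional ℝ V] [MeasurableSpace V] [BorelSpace V] in
/-- **(PC) FOR ONE GENERATION's DATA OF RECORD**: the generation-`j` data of the sequence `s` and branch `S` read `W` through `ζ_j((Ω_{j+1})ᶜ)` and
`w_j(Λ_{j+1}, Λ_{j+1}ᶜ ∩ Ω_{j+1}, S_{j+1})` only. [cite: Balaban1988Convergent, (2.21) p.258] -/
theorem genDataOfRecord_congr_of_weights (W₁ W₂ : TkWeights F N V K) {n : ℕ} (s : SeqOfRecord F ν M g K n) (S : ℕ → Set (Site (F.P K) 0)) (j : ℕ)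
    {hdec : DecidableEq (PBond (F.P K) j)} (hζ : W₁.ζ j = W₂.ζ j) (hw : W₁.w j = W₂.w j) :
    genDataOfRecord F N V ν M g K W₁ s S j = genDataOfRecord F N V ν M g K W₂ s S j := by
  unfold genDataOfRecord
  rw [hζ, hw]

/-- **★ (PC) FOR THE BRANCH OPERATOR**: `𝐓_k(s, S)` at two weight data agreeing on the generations `j < k` is the same operator.
[cite: Balaban1988Convergent, (2.20)–(2.21) p.258, (3.24) p.270] -/
theorem tkBranchOfRecord_congr_of_weights (W₁ W₂ : TkWeights F N V K) {n : ℕ} (s : SeqOfRecord F ν M g K n) (S : ℕ → Set (Site (F.P K) 0)) (k : ℕ)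
    (hζ : ∀ j, j < k → W₁.ζ j = W₂.ζ j) (hw : ∀ j, j < k → W₁.w j = W₂.w j) :
    tkBranchOfRecord F N V ν M g K W₁ s S k = tkBranchOfRecord F N V ν M g K W₂ s S k := by
  unfold tkBranchOfRecord
  exact tkOp_congr_of_lt _ _ k fun j hj => by rw [genDataOfRecord_congr_of_weights ν M g K W₁ W₂ s S j (hζ j hj) (hw j hj)]

/-- **★ (PC) FOR 11a's SLOT FAMILY**: `𝐓_k(s)` (the sum over the `{S_j}`-index of the branch operators, read at scale `k`) at two weight data agreeing on the
generations `j < k` is the same density-valued operation. [cite: Balaban1988Convergent, (2.18) p.257, (2.20)–(2.21) p.258] -/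
theorem TkOfRecord_congr_of_weights (W₁ W₂ : TkWeights F N V K) (k : ℕ) (s : SeqOfRecord F ν M g K k)
    (hζ : ∀ j, j < k → W₁.ζ j = W₂.ζ j) (hw : ∀ j, j < k → W₁.w j = W₂.w j) :
    TkOfRecord F N V ν M g K W₁ k s = TkOfRecord F N V ν M g K W₂ k s := by
  classical
  funext Φ Vk
  rw [TkOfRecord_apply, TkOfRecord_apply]
  refine Finset.sum_congr rfl fun S _ => ?_
  rw [tkBranchOfRecord_congr_of_weights ν M g K W₁ W₂ s S k hζ hw]

variable {𝔸 : Type*} [NormedRing 𝔸] [NormedAlgebra ℂ 𝔸] [CompleteSpace 𝔸]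

/-- **★ (PC) FOR THE §2-FORM SLOT AT LENGTH `k`**: `sect2Slot … W s t E U` reads `W` through the generations `j < k` only (the operand `e^{A_k(s)}` does not read
`W`). [cite: Balaban1988Convergent, (2.18) p.257, (2.20)–(2.23) p.258] -/
theorem sect2Slot_congr_of_weights (S : Sect2.Setting 𝔸 (SU N)) (Rz : Sect2.Residual (F.P K) 𝔸) (W₁ W₂ : TkWeights F N V K) {k : ℕ}
    (s : SeqOfRecord F ν M g K k) (t : Sect2.TermValues (F.P K) 𝔸 V M) (Ek : ℝ) (U : BgMap F N K)
    (hζ : ∀ j, j < k → W₁.ζ j = W₂.ζ j) (hw : ∀ j, j < k → W₁.w j = W₂.w j) :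
    sect2Slot F N V K S Rz W₁ s t Ek U = sect2Slot F N V K S Rz W₂ s t Ek U := by
  unfold sect2Slot
  rw [TkOfRecord_congr_of_weights ν M g K W₁ W₂ k s hζ hw]

end Record

/-! ## §2. The weight-level faces: `w_j` from `(χA_j, quad_j)`; 12a″'s weights over two residual data agreeing below `k` -/

section Weights

variable {F : T4Family} {N : ℕ} [NeZero N] {V : Type}

omit [NeZero N] in
/-- The A-weight `w_j = χA_j · e^{−½ quad_j}` of two data agreeing on `χA_j` and `quad_j` agree. [cite: Balaban1988Convergent, (2.21) p.258, (3.23) p.270] -/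
theorem TkWeights.w_congr {K : ℕ} (W₁ W₂ : TkWeights F N V K) (j : ℕ) (hχ : W₁.chiA j = W₂.chiA j) (hq : W₁.quad j = W₂.quad j) :
    W₁.w j = W₂.w j := by
  funext Λ' Y S ω
  simp only [TkWeights.w, hχ, hq]

variable [SeminormedAddCommGroup V] (ν : Stage7Numerics) (A₁ : ℝ) (p : B12.RunParams) (g : ℕ → ℝ)

/-- 12a″'s weights over two residual data with the same `ζ0_j` have the same `ζ_j`. [cite: Balaban1988Convergent, (1.11) p.248, (2.21) p.258] -/
theorem tkWeightsOfRecordP_ζ_congr (Z₁ Z₂ : TkResidualW F N V p.K) (j : ℕ) (h : Z₁.ζ0 j = Z₂.ζ0 j) :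
    (tkWeightsOfRecordP F N V ν A₁ p g Z₁).ζ j = (tkWeightsOfRecordP F N V ν A₁ p g Z₂).ζ j := by
  funext Y ω
  rw [tkWeightsOfRecordP_ζ, tkWeightsOfRecordP_ζ, zetaWtP_apply, zetaWtP_apply, h]

/-- 12a″'s weights over two residual data with the same `quad_j` have the same A-weight `w_j` (the A-side `χA = chiAW` is the pinned one). [cite: Balaban1988Convergent, (2.21) p.258, (3.21) p.269] -/
theorem tkWeightsOfRecordP_w_congr (Z₁ Z₂ : TkResidualW F N V p.K) (j : ℕ) (h : Z₁.quad j = Z₂.quad j) :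
    (tkWeightsOfRecordP F N V ν A₁ p g Z₁).w j = (tkWeightsOfRecordP F N V ν A₁ p g Z₂).w j :=
  TkWeights.w_congr _ _ j rfl (by rw [tkWeightsOfRecordP_quad, tkWeightsOfRecordP_quad, h])

end Weights

section Prefix

variable {F : T4Family} {N : ℕ} [NeZero N] {V : Type} [NormedAddCommGroup V] [InnerProductSpace ℝ V] [FiniteDimensional ℝ V]
  [MeasurableSpace V] [BorelSpace V]
variable {𝔸 : Type*} [NormedRing 𝔸] [NormedAlgebra ℂ 𝔸] [CompleteSpace 𝔸]
variable (ν : Stage7Numerics) (M : ℕ) (A₁ : ℝ) (p : B12.RunParams) (g : ℕ → ℝ)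

/-- **★ THE PREFIX BRIDGE FOR 12a″'s WEIGHTS**: two residual data on the torus of the run that agree on `ζ0_j` and `quad_j` for `j < k` give the SAME §2-form
slot at every sequence of length `k` (every setting, residual data, term values, constant, background map) — the rewrite a history-indexed residual slot with
the prefix law needs between the weights of `init s` and of `s`. [cite: Balaban1988Convergent, (2.18) p.257, (2.20)–(2.23) p.258, p.267] -/
theorem sect2Slot_tkWeightsOfRecordP_congr_of_prefix (S : Sect2.Setting 𝔸 (SU N)) (Rz : Sect2.Residual (F.P p.K) 𝔸)
    (Z₁ Z₂ : TkResidualW F N V p.K) {k : ℕ} (hζ : ∀ j, j < k → Z₁.ζ0 j = Z₂.ζ0 j) (hq : ∀ j, j < k → Z₁.quad j = Z₂.quad j)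
    (s : SeqOfRecord F ν M g p.K k) (t : Sect2.TermValues (F.P p.K) 𝔸 V M) (Ek : ℝ) (U : BgMap F N p.K) :
    sect2Slot F N V p.K S Rz (tkWeightsOfRecordP F N V ν A₁ p g Z₁) s t Ek U =
      sect2Slot F N V p.K S Rz (tkWeightsOfRecordP F N V ν A₁ p g Z₂) s t Ek U :=
  sect2Slot_congr_of_weights ν M g p.K S Rz _ _ s t Ek U (fun j hj => tkWeightsOfRecordP_ζ_congr ν A₁ p g Z₁ Z₂ j (hζ j hj))
    (fun j hj => tkWeightsOfRecordP_w_congr ν A₁ p g Z₁ Z₂ j (hq j hj))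

end Prefix

end Summit.QuantumFields.YangMills.Theorems.BalabanUVNodesN11TkBranchWeightCongr

end
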